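import Summits.BirchSwinnertonDyer.BirchSwinnertonDyer.Theorems.AdditiveKolyvaginRoadKolyvaginIsoBound
import Summits.BirchSwinnertonDyer.BirchSwinnertonDyer.Theorems.AdditiveKolyvaginRoadKolyvaginTransverseLagrangian
import Summits.BirchSwinnertonDyer.BirchSwinnertonDyer.Theorems.AdditiveKolyvaginRoadKolyvaginFrobeniusRingClassTrivial
import HarnessLib

/-!
# Route `AdditiveKolyvaginRoad`, crux `LevelKolyvaginSystemsAdditive` (item stmt-BirchSwinnertonDyer-21396, KS′):
# THE LOCAL AXIS LEMMA at a Kolyvagin prime — an isotropic ramified eigenclass is TRANSVERSE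
# (cell `pub/bsd-wall`, width seat `bsd-wall-akr-p2x-w3` g7; `--supports stmt-BirchSwinnertonDyer-21396`, helper; the E-side content of the
# RAISE half of the twin dichotomy at a Kolyvagin prime for the mixed level spaces — binder (Jump) of `…LevelSystemsOfSeedCanonical`,
# `hRaise` of `…LevelSystemsOfSelmerDichotomy`, (Twin) of `…LevelSystemsCanonicalUpperLevels`)

WHY. The landed Kolyvagin-prime package ((REC), `perf` in the order Kummer × transverse, `line`, the isotropies, the Poitou–Tate jump
`hjump_of_poitouTateP`, (IsoBound)) does not by itself exclude that the `c`-stable isotropic image of a relaxed Selmer space in the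
eigen-plane `H¹(K_λ, E[p])^μ = f^μ ⊕ tr^μ` is an isotropic line OFF the two axes; what excludes it is that the local Tate form is the cup
product of an ALTERNATING Weil pairing, so that `b(φ, φ) = ±2 e(φ(F), φ(τ))` and an isotropic vector lies on an axis. In the tree's
cocycle currency this is: a `μ`-eigenclass `x` NOT Selmer at `λ` with `loc_λ x ∪ₑ loc_λ x = 0` has `[x, F] = 0` at Gross's Frobenius lift `F`
(`h1Eval_frob_eq_zero_of_cupProduct_self_eq_zero_P`) — and THIS FILE turns «`[x, F] = 0`» into «`x` is transverse at `λ`»: Gross's `F`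
fixes `K[ℓ]` (`mem_ringClassStabilizer_of_absGaloisRestrict_eq_sq`), so the reference cocycle `θ₀ = log_χ ⊗ Q` built from the Kolyvagin
character `χ : Γ_{K_λ} → Gal(K[ℓ]/K)` (`exists_kolyvagin_character_P`) and a generator `Q` of the inertia eigen-line of `x` vanishes at the
lift of `F`; two such additive maps with inertia values on one line are proportional (`exists_eq_zsmul_of_apply_frob_eq_zero_P`), the
constant is a unit because `θ₀(σ₁) = Q ≠ 0`, so the cocycle of `x` on `Γ_{K_λ}` is a multiple of `θ₀` and vanishes on `res⁻¹(Stab K[ℓ])`,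
i.e. `loc_λ x` lies in the genuine transverse condition (`htrIncl_transverseLocalCondition_P`).

WHAT. `mem_transverseLocalKerP_of_cupProduct_self_eq_zero_P` — at a Kolyvagin prime `λ ∋ ℓ` of the frame (`K` imaginary quadratic,
`d_K < −4`, `c ≠ 1`, `ρ̄_{E,p}` onto, `p` odd), for every Weil-type pairing `e` on `E[p]` and each sign `s`: a `c`-eigenclass
`x ∈ H¹(K, E[p])^{s}` NOT Selmer at `λ` with `loc_λ x ∪ₑ loc_λ x = 0` lies in `transverseLocalKerP W K p ι ℓ λ`.

HONEST FRAMING: one theorem; 0 definitions, 0 named facts, 0 `sorry`; closes nothing. BSD is not proved by any of this.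

References: [cite: GrossLMS1991, §3, Prop. 8.1, Prop. 8.2] [cite: WZhang2014, §8.1 (H¹_tr), Lemma 8.4 (1)] [cite: MazurRubin2004, Lemma 4.1.7,
Prop. 1.3.2] [cite: McCallumLMS1991, §4 (H¹_f ⊕ H¹_s), Lemma 5.3].
-/

-- single-conjunct summit: `Summit.BirchSwinnertonDyer.BirchSwinnertonDyer.…` repeats the name by design
set_option linter.dupNamespace false

noncomputable section

open scoped Classical Pointwise

namespace Summit.BirchSwinnertonDyer.BirchSwinnertonDyer.Theorems.AdditiveKoly

open CategoryTheory WeierstrassCurve Field Function NumberField IsDedekindDomain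
open Literature.NumberTheory.EllipticCurves Literature.NumberTheory.EllipticCurves.ModularForms
  Literature.NumberTheory.GaloisRepresentations Module
open Literature.NumberTheory.GaloisRepresentations.DiscreteGaloisModule (mu MuCarrier tateDual tateDualEval TateDual)
open Literature.NumberTheory.GaloisCohomology
open Summit.BirchSwinnertonDyer.Rank1Residual.X11b.Three.Koly.Method2
open Summit.BirchSwinnertonDyer.Rank1Residual.GaloisImage
open Summit.BirchSwinnertonDyer.Rank1Residual.JET Summit.BirchSwinnertonDyer.Rank1Residual.X11b
open scoped ContRepresentation

variable (W : WeierstrassCurve ℚ) (K : Type) [Field K] [NumberField K] (p : ℕ) [W.IsElliptic] [W.IsGloballyMinimal]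
  [Fact p.Prime] [∀ v : Place K, CompactSpace (absoluteGaloisGroup (Place.Completion v))]
  [Finite (geomTorsion (W.baseChange K) ((p ^ 1 : ℕ) : ℤ))]

set_option maxHeartbeats 800000 in
-- the cocycle bookkeeping at a Kolyvagin prime is heavy (same budget as the tree's (Perf) ∕ (IsoBound) files)
/-- **The local axis lemma at a Kolyvagin prime.** At a Kolyvagin prime `λ ∋ ℓ` of the frame (`K` imaginary quadratic with `d_K < −4`,
`c ≠ 1`, `ρ̄_{E,p}` onto, `p` odd), for every Weil-type pairing `e` on `E[p]` and each sign `s`: if `x ∈ H¹(K, E[p])^{s}` is NOT Selmer at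
`λ` and `loc_λ x ∪ₑ loc_λ x = 0`, then `x` is TRANSVERSE at `λ`. Proof: `[x, F] = 0` at Gross's Frobenius lift
(`h1Eval_frob_eq_zero_of_cupProduct_self_eq_zero_P`); `F` fixes `K[ℓ]` (`mem_ringClassStabilizer_of_absGaloisRestrict_eq_sq`); the reference
`θ₀ = log_χ ⊗ Q` (`χ` the Kolyvagin character, `Q` a generator of the inertia eigen-line of `x`) vanishes at the lift of `F` and on
`res⁻¹(Stab K[ℓ])`, and `θ₀(σ₁) = Q ≠ 0`; by `exists_eq_zsmul_of_apply_frob_eq_zero_P` the local cocycle of `x` is a UNIT multiple of `θ₀`, hence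
vanishes on `res⁻¹(Stab K[ℓ])`; conclude by `htrIncl_transverseLocalCondition_P`. [cite: GrossLMS1991, §3, Prop. 8.1]
[cite: WZhang2014, §8.1 (H¹_tr), Lemma 8.4 (1)] [cite: MazurRubin2004, Lemma 4.1.7] -/
theorem mem_transverseLocalKerP_of_cupProduct_self_eq_zero_P (hK : IsImaginaryQuadratic K) (hp2 : p ≠ 2)
    (hd : NumberField.discr K < -4) (hsurj : W.HasSurjectiveModNGaloisRep p) (ι : K →+* ℂ) {c : K ≃ₐ[ℚ] K} (hc : c ≠ 1)
    (e : geomTorsion (W.baseChange K) ((p ^ 1 : ℕ) : ℤ) → geomTorsion (W.baseChange K) ((p ^ 1 : ℕ) : ℤ) →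
      AlgebraicClosure K)
    (hμ : ∀ P Q, e P Q ^ (p ^ 1) = 1) (hadd₁ : ∀ P₁ P₂ Q, e (P₁ + P₂) Q = e P₁ Q * e P₂ Q)
    (hadd₂ : ∀ P Q₁ Q₂, e P (Q₁ + Q₂) = e P Q₁ * e P Q₂) (halt : ∀ Q, e Q Q = 1)
    (hnondeg : ∀ Q, (∀ P, e P Q = 1) → Q = 0)
    (hgal : ∀ (σ : absoluteGaloisGroup K) (P Q : geomTorsion (W.baseChange K) ((p ^ 1 : ℕ) : ℤ)),
      σ • e P Q = e (σ • P) (σ • Q))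
    {ℓ : ℕ} (hℓ : Zhang2014.IsKolyvaginPrime (W.conductorNorm ℤ) W K p ℓ) (v : HeightOneSpectrum (𝓞 K))
    (hv : (ℓ : 𝓞 K) ∈ v.asIdeal) (s : Bool) {x : Vp W K p}
    (hxs : conjAct W c ((p ^ 1 : ℕ) : ℤ) x = sgnP s • x)
    (hxK : x ∉ selmerLocalKer (W.baseChange K) (v.adicCompletion K) ((p ^ 1 : ℕ) : ℤ))
    (hxx : (weilContPairingLocal (W.baseChange K) (p ^ 1) e hμ hadd₁ hadd₂ hgal (Sum.inr v)).cupProduct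
      (galoisCohomology.localization ((W.baseChange K).torsionGaloisModule ((p ^ 1 : ℕ) : ℤ)) (Sum.inr v) 1 x)
      (galoisCohomology.localization ((W.baseChange K).torsionGaloisModule ((p ^ 1 : ℕ) : ℤ)) (Sum.inr v) 1 x) = 0) :
    x ∈ transverseLocalKerP W K p ι ℓ v := by
  classical
  have hp : p.Prime := Fact.out
  have hp1 : Nat.Prime (p ^ 1) := by rw [pow_one]; exact hp
  have hp12 : p ^ 1 ≠ 2 := by rw [pow_one]; exact hp2
  have hk1 : 1 ≤ Zhang2014.kolyvaginIndex W p ℓ := hℓ.2.2.2.2.2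
  have hℓ0 : ℓ ≠ 0 := hℓ.1.ne_zero
  have hpℓ : p ∣ ℓ + 1 := by
    have h := ((Zhang2014.le_kolyvaginIndex_iff (W := W) (p := p)).mp hk1).1
    rwa [pow_one] at h
  haveI : NeZero (p ^ 1 : ℕ) := ⟨pow_ne_zero 1 hp.ne_zero⟩
  -- ### the Kolyvagin character `χ : Γ_λ → Gal(K[ℓ]/K)` (kernel `res⁻¹(Stab K[ℓ])`, cyclic image of order `ℓ + 1`)
  obtain ⟨-, -, χ, σ₁, -, -, hχ1, hχlc, hχgen, hord⟩ := exists_kolyvagin_character_P W K p hK hd ι hℓ v hv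
  -- ### the place, Gross's Frobenius lift, the local cocycle of `x` (as in (IsoBound), Case C)
  have hℓG := isKolyvaginPrime_pow_one_of_zhang W K p hK hp2 hsurj hℓ
  have hvw : v = hℓG.place := hℓG.mem_iff.mp hv
  subst hvw
  obtain ⟨hgood, h3v⟩ := GlobalDuality.hasGoodReductionAt_of_zhangKolyvaginPrime W K hℓ hℓG.place hv 1
  have hvbad : hℓG.place ∉ (W.baseChange K).badPlaces (𝓞 K) := fun h ↦ h hgood
  obtain ⟨𝔐, h𝔐⟩ := hℓG.place.localPrimesAbove_nonempty
  have h𝔓 : hℓG.place.primeBelow (closureEmb (K := K) (hℓG.place.adicCompletion K)) 𝔐 ∈ hℓG.place.primesAbove :=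
    HeightOneSpectrum.primeBelow_mem_primesAbove h𝔐
  obtain ⟨h, c₀, F, ht, -, -, hμinv, hFrob, hF, hFsq, hFT, hcF, htt, ⟨Qp, hQp0, hQp⟩, ⟨Qm, hQm0, hQm⟩, -⟩ :=
    exists_frobeniusLift_of_isKolyvaginPrime W hK (p := p ^ 1) hp1 hp12 hc hℓG h𝔓
  have hFT' : F ∈ torsionFixing (W.baseChange K) ((p ^ 1 : ℕ) : ℤ) := hFT
  haveI := h𝔓.1
  obtain ⟨gF, hgF⟩ := KolyLocal.exists_absGaloisRestrict_eq_of_mem_decompositionSubgroup K hℓG.place h𝔐 hF.mem_stabilizer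
  -- Gross's lift fixes `K[ℓ]`: `χ(g_F) = 1`
  have hFS : F ∈ ringClassStabilizer K ι ℓ ℓ := mem_ringClassStabilizer_of_absGaloisRestrict_eq_sq hK ι hℓ0 hc ht hFsq
  have hχF : χ gF = 1 := (hχ1 gF).mpr (by rw [hgF]; exact hFS)
  -- `[x, F] = 0`
  have hxF := h1Eval_frob_eq_zero_of_cupProduct_self_eq_zero_P W K p hK hp2 hsurj e hμ hadd₁ hadd₂ halt hnondeg hgal hℓ
    hℓG.place hv h𝔐 ht hFrob hμinv hF hFT' hcF htt hgF s hxs hxK hxx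
  -- `Γ_λ` fixes `E[p]`; the local cocycle `fx`
  have hD : ∀ d ∈ (hℓG.place.primeBelow (closureEmb (K := K) (hℓG.place.adicCompletion K)) 𝔐).decompositionSubgroup
      (absoluteGaloisGroup K), d ∈ torsionFixing (W.baseChange K) ((p ^ 1 : ℕ) : ℤ) := fun d hd' ↦
    GlobalDuality.decompositionSubgroup_le_torsionFixing W K hK hℓ hk1 hℓG.place hv h𝔓 hd'
  have hres : ∀ g : absoluteGaloisGroup (hℓG.place.adicCompletion K),
      absGaloisRestrict K (hℓG.place.adicCompletion K) g ∈ (hℓG.place.primeBelow (closureEmb (K := K)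
        (hℓG.place.adicCompletion K)) 𝔐).decompositionSubgroup (absoluteGaloisGroup K) := fun g ↦ by
    rw [← resGal_eq_absGaloisRestrict, resGal_eq]; exact resGalOfEmb_mem_decompositionSubgroup _ h𝔐 g
  have hfixA : ∀ (g : absoluteGaloisGroup (hℓG.place.adicCompletion K))
      (Q : geomTorsion (W.baseChange K) ((p ^ 1 : ℕ) : ℤ)), absGaloisRestrict K (hℓG.place.adicCompletion K) g • Q = Q :=
    fun g Q ↦ smul_eq_of_mem_torsionFixing (W.baseChange K) _ (hD _ (hres g)) Q
  have hpT : ∀ Q : geomTorsion (W.baseChange K) ((p ^ 1 : ℕ) : ℤ), (p ^ 1) • Q = 0 := fun Q ↦ by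
    have := (mem_geomTorsion_iff (W.baseChange K) ((p ^ 1 : ℕ) : ℤ) _).mp Q.2
    apply Subtype.ext
    rw [AddSubgroupClass.coe_nsmul, ← natCast_zsmul]
    exact this
  have hpT' : ∀ Q : geomTorsion (W.baseChange K) ((p ^ 1 : ℕ) : ℤ), p • Q = 0 := fun Q ↦
    (congrArg (fun k : ℕ ↦ k • Q) (pow_one p)).symm.trans (hpT Q)
  have hpTz : ∀ Q : geomTorsion (W.baseChange K) ((p ^ 1 : ℕ) : ℤ), (p : ℤ) • Q = 0 := fun Q ↦ by
    rw [natCast_zsmul]; exact hpT' Q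
  have hcard : Nat.card (geomTorsion (W.baseChange K) ((p ^ 1 : ℕ) : ℤ)) = (p ^ 1) ^ 2 :=
    card_torsionPoints_eq_sq_holds (W.baseChange K) (AlgebraicClosure K) (n := p ^ 1) (by exact_mod_cast hp1.ne_zero)
  obtain ⟨φx, hφx⟩ : ∃ φ, φ = reprCocycle (W.baseChange K) ((p ^ 1 : ℕ) : ℤ) x := ⟨_, rfl⟩
  obtain ⟨fx, hfxdef⟩ : ∃ f : contOneCocycles ((DiscreteGaloisModule.toLocal ((W.baseChange K).torsionGaloisModule
      ((p ^ 1 : ℕ) : ℤ)) (Sum.inr hℓG.place)).toTopRep),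
      f = contOneCocycles.pullback (absGaloisRestrict K (hℓG.place.adicCompletion K))
        (X := discreteTopRep (absoluteGaloisGroup K) (geomTorsion (W.baseChange K) ((p ^ 1 : ℕ) : ℤ)))
        (Y := (DiscreteGaloisModule.toLocal ((W.baseChange K).torsionGaloisModule ((p ^ 1 : ℕ) : ℤ))
          (Sum.inr hℓG.place)).toTopRep)
        (TopRep.ofHom ⟨ContinuousLinearMap.id ℤ (geomTorsion (W.baseChange K) ((p ^ 1 : ℕ) : ℤ)), fun _ => rfl⟩) φx :=
    ⟨_, rfl⟩
  have hfx : ∀ g, fx.1 g = φx.1 (absGaloisRestrict K (hℓG.place.adicCompletion K) g) := fun g ↦ by rw [hfxdef]; rfl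
  have hlocx : galoisCohomology.localization ((W.baseChange K).torsionGaloisModule ((p ^ 1 : ℕ) : ℤ))
      (Sum.inr hℓG.place) 1 x = oneCocycleClass ((DiscreteGaloisModule.toLocal ((W.baseChange K).torsionGaloisModule
        ((p ^ 1 : ℕ) : ℤ)) (Sum.inr hℓG.place)).toTopRep) fx := by
    rw [← oneCocycleClass_reprCocycle (W.baseChange K) ((p ^ 1 : ℕ) : ℤ) x, hfxdef, hφx]
    exact res_torsionGaloisModule_oneCocycleClass (W.baseChange K) ((p ^ 1 : ℕ) : ℤ) (hℓG.place.adicCompletion K) _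
  have hfx_add : ∀ g g', fx.1 (g * g') = fx.1 g + fx.1 g' := fun g g' ↦
    (fx.2 g g').trans (congrArg (fun Q ↦ fx.1 g + Q) (hfixA g (fx.1 g')))
  have hfxF : fx.1 gF = 0 := by rw [hfx, hgF, ← hxF, hφx]; rfl
  -- ### the inertia eigen-line `ℤ Q`, `Q = [x, i] ≠ 0` (`x` is ramified at `λ`)
  obtain ⟨i, hiI, hQ0⟩ : ∃ i ∈ (hℓG.place.primeBelow (closureEmb (K := K) (hℓG.place.adicCompletion K)) 𝔐).inertia
      (absoluteGaloisGroup K), φx.1 i ≠ 0 := by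
    by_contra hall
    push Not at hall
    apply hxK
    rw [← oneCocycleClass_reprCocycle (W.baseChange K) ((p ^ 1 : ℕ) : ℤ) x, ← hφx]
    exact ((W.baseChange K).oneCocycleClass_mem_selmerLocalKer_iff hgood h3v h𝔓 φx).mpr hall
  have hν : sgnP s = 1 ∨ sgnP s = -1 := by cases s <;> simp [sgnP]
  have hν' : -sgnP s = 1 ∨ -sgnP s = -1 := by rcases hν with h1 | h1 <;> simp [h1]
  obtain ⟨P, hP0, hP⟩ : ∃ P : geomTorsion (W.baseChange K) ((p ^ 1 : ℕ) : ℤ), P ≠ 0 ∧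
      ht.torsionMap W ((p ^ 1 : ℕ) : ℤ) P = sgnP s • P := by
    cases s
    · exact ⟨Qm, hQm0, by rw [show sgnP false = -1 from rfl, neg_one_zsmul]; exact hQm⟩
    · exact ⟨Qp, hQp0, by rw [show sgnP true = 1 from rfl, one_zsmul]; exact hQp⟩
  have hQs : ht.torsionMap W ((p ^ 1 : ℕ) : ℤ) (φx.1 i) = -(sgnP s • φx.1 i) := by
    rw [hφx]
    exact torsionMap_h1Eval_inertia_eq_neg W (p := p ^ 1) hp1 hℓG hvbad h𝔓 ht hFrob hμinv hxs hiI
  have hEm : ∀ a, ht.torsionMap W ((p ^ 1 : ℕ) : ℤ) a = -(sgnP s • a) → a ∈ AddSubgroup.zmultiples (φx.1 i) :=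
    fun a ha ↦ KolyLocal.mem_zmultiples_of_eigen_of_eigen hp1 hp12 hcard hpT (ht.torsionMap W _) hν' hQ0
      (by rw [neg_smul]; exact hQs) hP0 (by rw [neg_smul, neg_neg]; exact hP) (by rw [neg_smul]; exact ha)
  have hxI : ∀ g, absGaloisRestrict K (hℓG.place.adicCompletion K) g ∈
      (hℓG.place.primeBelow (closureEmb (K := K) (hℓG.place.adicCompletion K)) 𝔐).inertia (absoluteGaloisGroup K) →
      ht.torsionMap W ((p ^ 1 : ℕ) : ℤ) (fx.1 g) = -(sgnP s • fx.1 g) := fun g hg ↦ by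
    rw [hfx, hφx]
    exact torsionMap_h1Eval_inertia_eq_neg W (p := p ^ 1) hp1 hℓG hvbad h𝔓 ht hFrob hμinv hxs hg
  obtain ⟨gi, hgi⟩ := KolyLocal.exists_absGaloisRestrict_eq_of_mem_decompositionSubgroup K hℓG.place h𝔐
    (Ideal.inertia_le_stabilizer _ hiI)
  have hram : ∃ g, absGaloisRestrict K (hℓG.place.adicCompletion K) g ∈
      (hℓG.place.primeBelow (closureEmb (K := K) (hℓG.place.adicCompletion K)) 𝔐).inertia (absoluteGaloisGroup K) ∧
      fx.1 g ≠ 0 := ⟨gi, by rw [hgi]; exact hiI, by rw [hfx, hgi]; exact hQ0⟩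
  -- ### the reference additive map `θ₀ = log_χ ⊗ Q`
  let lg : ringClassGal ι ℓ → ℕ := fun r ↦ if hr : ∃ j : ℕ, r = χ σ₁ ^ j then Classical.choose hr else 0
  have hlg : ∀ g, χ g = χ σ₁ ^ lg (χ g) := fun g ↦ by
    simp only [lg, dif_pos (hχgen g)]
    exact Classical.choose_spec (hχgen g)
  let θ₀ : C(absoluteGaloisGroup (hℓG.place.adicCompletion K), (DiscreteGaloisModule.toLocal
      ((W.baseChange K).torsionGaloisModule ((p ^ 1 : ℕ) : ℤ)) (Sum.inr hℓG.place)).toTopRep) :=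
    ⟨fun g ↦ ((lg (χ g) : ℕ) : ℤ) • φx.1 i,
      (IsLocallyConstant.comp hχlc (fun r ↦ ((lg r : ℕ) : ℤ) • φx.1 i)).continuous⟩
  have hθ₀ : ∀ g, θ₀ g = ((lg (χ g) : ℕ) : ℤ) • φx.1 i := fun _ ↦ rfl
  -- congruent exponents give equal values (`p ∣ ℓ + 1 = ord χ(σ₁)`, `p • Q = 0`)
  have hval : ∀ a b : ℕ, a ≡ b [MOD ℓ + 1] → ((a : ℕ) : ℤ) • φx.1 i = ((b : ℕ) : ℤ) • φx.1 i := by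
    intro a b hab
    obtain ⟨k, hk⟩ := (Nat.modEq_iff_dvd.mp (hab.of_dvd hpℓ))
    have hb : ((b : ℕ) : ℤ) = (a : ℤ) + (p : ℤ) * k := by linarith
    rw [hb, add_zsmul, mul_zsmul', hpTz, zsmul_zero, add_zero]
  have hθ₀_add : ∀ g g', θ₀ (g * g') = θ₀ g + θ₀ g' := by
    intro g g'
    rw [hθ₀, hθ₀, hθ₀, ← add_zsmul, ← Nat.cast_add]
    refine hval _ _ ?_
    rw [← hord]
    refine pow_eq_pow_iff_modEq.mp ?_
    have e1 : χ σ₁ ^ (lg (χ g) + lg (χ g')) = χ g * χ g' := by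
      rw [pow_add, ← hlg g, ← hlg g']
    rw [e1, ← map_mul, ← hlg (g * g')]
  have hθ₀_one : ∀ g, χ g = 1 → θ₀ g = 0 := by
    intro g hg
    rw [hθ₀]
    have h0 : lg (χ g) ≡ 0 [MOD ℓ + 1] := by
      rw [← hord, Nat.modEq_zero_iff_dvd]
      exact orderOf_dvd_of_pow_eq_one (by rw [← hlg, hg])
    rw [hval _ _ h0, Nat.cast_zero, zero_zsmul]
  have hθ₀F : θ₀ gF = 0 := hθ₀_one gF hχF
  have hθ₀σ : θ₀ σ₁ = φx.1 i := by
    rw [hθ₀]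
    have h1 : lg (χ σ₁) ≡ 1 [MOD ℓ + 1] := by
      rw [← hord]
      refine pow_eq_pow_iff_modEq.mp ?_
      rw [← hlg σ₁]
      exact (pow_one (χ σ₁)).symm
    rw [hval _ _ h1, Nat.cast_one, one_zsmul]
  have hfI : ∀ g, absGaloisRestrict K (hℓG.place.adicCompletion K) g ∈
      (hℓG.place.primeBelow (closureEmb (K := K) (hℓG.place.adicCompletion K)) 𝔐).inertia (absoluteGaloisGroup K) →
      fx.1 g ∈ AddSubgroup.zmultiples (φx.1 i) ∧ θ₀ g ∈ AddSubgroup.zmultiples (φx.1 i) := fun g hg ↦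
    ⟨hEm _ (hxI g hg), by rw [hθ₀]; exact AddSubgroup.zsmul_mem_zmultiples _ _⟩
  -- ### proportionality: `θ₀ = a • fx` with `a` a unit mod `p`
  have h3v' : ((p ^ 1 : ℕ) : 𝓞 K) ∉ hℓG.place.asIdeal := by
    have := h3v; rwa [Int.cast_natCast] at this
  obtain ⟨a, ha⟩ := exists_eq_zsmul_of_apply_frob_eq_zero_P K p hℓG.place h𝔐 h3v' hℓG.valuation_natCast hF hgF hpT'
    fx.1 θ₀ hfx_add hθ₀_add hfxF hθ₀F (addOrderOf_eq_prime (hpT' _) hQ0) hfI hram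
  have hpa : ¬ (p : ℤ) ∣ a := by
    rintro ⟨k, rfl⟩
    apply hQ0
    rw [← hθ₀σ, ha σ₁, mul_zsmul', hpTz, zsmul_zero]
  obtain ⟨u, w, huw⟩ : IsCoprime (p : ℤ) a :=
    (Irreducible.coprime_iff_not_dvd (Nat.prime_iff_prime_int.mp hp).irreducible).mpr hpa
  have hfxθ : ∀ g, fx.1 g = w • θ₀ g := fun g ↦ by
    have h1 : fx.1 g = (u * (p : ℤ)) • fx.1 g + (w * a) • fx.1 g := by rw [← add_zsmul, huw, one_zsmul]
    rw [h1, mul_zsmul _ u, hpTz, zsmul_zero, zero_add, mul_zsmul _ w]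
    exact congrArg (fun y ↦ w • y) (ha g).symm
  -- ### the cocycle of `x` vanishes on `res⁻¹(Stab K[ℓ])`: `loc_λ x` is genuinely transverse
  have hvan : ∀ g : absoluteGaloisGroup (hℓG.place.adicCompletion K),
      absGaloisRestrict K (hℓG.place.adicCompletion K) g ∈ ringClassStabilizer K ι ℓ ℓ → fx.1 g = 0 := fun g hg ↦ by
    rw [hfxθ g, hθ₀_one g ((hχ1 g).mpr hg), zsmul_zero]
  refine htrIncl_transverseLocalCondition_P W K p hK ι hℓ hℓG.place hv x ?_
  rw [hlocx]
  exact ⟨fx, hvan, rfl⟩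

end Summit.BirchSwinnertonDyer.BirchSwinnertonDyer.Theorems.AdditiveKoly

end
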